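import Literature.Geometry.DiscreteGeometry.KissingFacetPenalty
import HarnessLib

/-!
# The fan triangles of the Delaunay polyhedron of a kissing configuration: counting contact sides
# (Hales 2012, proof of Theorem 3 — the bookkeeping behind "Σ τ < tgt" ⇒ face and edge counts)

Topic `Literature/Geometry/DiscreteGeometry`; provefact brick for `Hales2012_contactGraphTame`,
continuing `KissingFacetPenalty.lean` (the budget inequality
`Σ_c Σ_{i<m_c−2} fanPenaltyLB X c i ≤ 4π − 20 sol₀` over the fan triangles of the facets of
`conv X`, `X = V/2`).  To draw consequences for the contact graph one has to count, over the
same family of `20` fan triangles, how many of their `60` sides are contact pairs.  This file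
PROVES the exact count:

* `fVert X c j` (the `j`-th vertex of the facet of `c`, a proof-free wrapper of `facetVertex`),
  `fanContacts X c i` (the number of contact sides of the `i`-th fan triangle of the facet of
  `c`, the `r` of Hales's `(r, s, t)`).
* `inner_fVert_zero_ne_half_of_diagonal`: a diagonal `{w 0, w k}` (`2 ≤ k ≤ m − 2`) of a facet
  is not a contact (contacts are hull edges, and hull edges inside a facet join consecutive
  vertices).
* `sum_fanContacts_eq_card_filter` (per facet): `Σ_{i<m−2} r(c,i)` is the number of contact
  SIDES of the facet polygon (each polygon side lies in exactly one fan triangle, each diagonal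
  in two, and diagonals are not contacts).
* `sum_card_contact_sides_eq` (all facets): the numbers of contact sides of the facets add up to
  twice the number of contact pairs (every contact pair is a hull edge and lies in exactly two
  facets).
* `card_fanTriangles` : there are `Σ_c (m_c − 2) = 20` fan triangles (Legendre), and the
  assembled identity **`sum_sum_three_sub_fanContacts`**:
  `Σ_c Σ_{i<m_c−2} (3 − r(c,i)) = 60 − 2 · #(contact pairs)` — the number of long sides, counted
  with multiplicity over the fan triangles.

Everything is PROVED; no named facts.

## References
* T. C. Hales, arXiv:1209.6043 (2012), proof of Theorem 2 (triangulation of `U_F`, parameters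
  `(r,s,t)`), Lemmas 4–6 and Theorem 3 (proof). [`Hales2012`]
-/

noncomputable section

namespace Literature.Geometry.DiscreteGeometry

open Real RealInnerProductSpace Finset

section FanCensus

local notation "E3" => EuclideanSpace ℝ (Fin 3)

variable {X : Finset E3}

/-! ### Part A. Vertices of a facet (proof-free wrapper) and contact sides of fan triangles -/

/-- **The `j`-th vertex of the facet of `c`** (counter-clockwise; `facetVertex` without the
proof argument `c ≠ 0`, with junk value `0` for `c = 0`). [folklore] -/
def fVert (X : Finset E3) (c : E3) (j : ℕ) : E3 :=
  if h : c ≠ 0 then facetVertex X c h j else 0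

/-- `fVert` agrees with `facetVertex`. [folklore] -/
theorem fVert_eq {c : E3} (hc : c ≠ 0) (j : ℕ) : fVert X c j = facetVertex X c hc j := by
  unfold fVert; rw [dif_pos hc]

/-- **The number of contact sides (`r` of Hales's type `(r, s, t)`) of the `i`-th fan triangle
`(w 0, w (i+1), w (i+2))` of the facet of `c`.** [cite: Hales2012, proof of Theorem 2] -/
def fanContacts (X : Finset E3) (c : E3) (i : ℕ) : ℕ :=
  contactCount ⟪fVert X c (i + 1), fVert X c (i + 2)⟫ ⟪fVert X c 0, fVert X c (i + 2)⟫
    ⟪fVert X c 0, fVert X c (i + 1)⟫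

/-- `fanContacts ≤ 3`. [folklore] -/
theorem fanContacts_le_three (X : Finset E3) (c : E3) (i : ℕ) : fanContacts X c i ≤ 3 := by
  unfold fanContacts contactCount
  split_ifs <;> omega

/-- The constant of the main estimate of a fan triangle is `trianglePenaltyLB` of its side
cosines (in the `fVert` spelling). [folklore] -/
theorem fanPenaltyLB_eq {c : E3} (hc : c ≠ 0) (i : ℕ) :
    fanPenaltyLB X c i = trianglePenaltyLB ⟪fVert X c (i + 1), fVert X c (i + 2)⟫
      ⟪fVert X c 0, fVert X c (i + 2)⟫ ⟪fVert X c 0, fVert X c (i + 1)⟫ := by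
  unfold fanPenaltyLB; rw [dif_pos hc, fVert_eq hc, fVert_eq hc, fVert_eq hc]

/-- Equality of pairs of values of a function injective on `range m`. [folklore] -/
theorem pair_indices_of_pair_eq {α : Type*} [DecidableEq α] {f : ℕ → α} {m : ℕ}
    (hf : Set.InjOn f (range m : Set ℕ)) {a b c d : ℕ} (ha : a < m) (hb : b < m) (hc : c < m)
    (hd : d < m) (hab : a ≠ b) (h : ({f a, f b} : Finset α) = {f c, f d}) :
    (a = c ∧ b = d) ∨ (a = d ∧ b = c) := by
  have hmem : ∀ x ∈ ({f a, f b} : Finset α), x ∈ ({f c, f d} : Finset α) := fun x hx => h ▸ hx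
  have hmem' : ∀ x ∈ ({f c, f d} : Finset α), x ∈ ({f a, f b} : Finset α) := fun x hx => h ▸ hx
  have hI : ∀ {i j : ℕ}, i < m → j < m → f i = f j → i = j := fun hi hj hij =>
    hf (mem_coe.2 (mem_range.2 hi)) (mem_coe.2 (mem_range.2 hj)) hij
  have ha' := hmem (f a) (mem_insert_self _ _)
  have hb' := hmem (f b) (mem_insert_of_mem (mem_singleton_self _))
  rw [mem_insert, mem_singleton] at ha' hb'
  rcases ha' with hac | had
  · have hac' := hI ha hc hac
    rcases hb' with hbc | hbd
    · exact absurd (hac'.trans (hI hb hc hbc).symm) hab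
    · exact Or.inl ⟨hac', hI hb hd hbd⟩
  · have had' := hI ha hd had
    rcases hb' with hbc | hbd
    · exact Or.inr ⟨had', hI hb hc hbc⟩
    · exact absurd (had'.trans (hI hb hd hbd).symm) hab

/-- **A diagonal of a facet is not a contact**: for a facet normal `c` with `m` vertices
`w 0, …, w (m−1)` and `2 ≤ k ≤ m − 2`, `⟪w 0, w k⟫ ≠ 1/2` — a contact pair is a hull edge
(`pair_mem_hullEdges_of_contact`) and a hull edge inside a facet joins consecutive vertices
(`consecutive_of_mem_hullEdges`). [folklore] -/
theorem inner_fVert_zero_ne_half_of_diagonal (hX1 : ∀ y ∈ X, ‖y‖ = 1)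
    (hp : ∀ y ∈ X, ∀ y' ∈ X, y ≠ y' → ⟪y, y'⟫ ≤ 1 / 2)
    (h0 : (0 : E3) ∈ interior (convexHull ℝ (X : Set E3))) {c : E3} (hc : c ∈ facetNormals X)
    {k : ℕ} (hk2 : 2 ≤ k) (hkm : k + 2 ≤ (tightSet X c).card) :
    ⟪fVert X c 0, fVert X c k⟫ ≠ 1 / 2 := by
  set hc0 := ne_zero_of_mem_facetNormals hX1 hc
  set m := (facetAngles X c hc0).card with hm
  have hmt : (tightSet X c).card = m := (card_facetAngles hX1 hc0).symm
  rw [hmt] at hkm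
  rw [fVert_eq hc0, fVert_eq hc0]
  set w := facetVertex X c hc0 with hw
  intro hhalf
  have hinj := facetVertex_injOn (X := X) hc0
  have h0m : w 0 ∈ tightSet X c := facetVertex_mem hc0 (by omega)
  have hkm' : w k ∈ tightSet X c := facetVertex_mem hc0 (by omega)
  have hne : w 0 ≠ w k := fun h => by
    have := hinj (mem_coe.2 (mem_range.2 (by omega))) (mem_coe.2 (mem_range.2 (by omega))) h
    omega
  have hedge : ({w 0, w k} : Finset E3) ∈ hullEdges X :=
    pair_mem_hullEdges_of_contact hX1 (by norm_num) hp (mem_tightSet.1 h0m).1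
      (mem_tightSet.1 hkm').1 hne hhalf
  have hsub : ({w 0, w k} : Finset E3) ⊆ tightSet X c := by
    intro y hy
    rw [mem_insert, mem_singleton] at hy
    rcases hy with rfl | rfl
    · exact h0m
    · exact hkm'
  obtain ⟨j, hj, hjeq⟩ := consecutive_of_mem_hullEdges hX1 h0 hc hedge hsub
  have hj1 : (j + 1) % m < m := Nat.mod_lt _ (by omega)
  rcases pair_indices_of_pair_eq hinj (by omega) (by omega) hj hj1 (by omega) hjeq with
    ⟨h1, h2⟩ | ⟨h1, h2⟩
  · -- `0 = j`, `k = (j+1) % m = 1`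
    rw [← h1, zero_add, Nat.mod_eq_of_lt (by omega)] at h2
    omega
  · -- `0 = (j+1) % m` forces `j = m - 1 = k`
    rcases Nat.lt_or_ge (j + 1) m with hlt | hge
    · rw [Nat.mod_eq_of_lt hlt] at h1; omega
    · have : j = m - 1 := by omega
      omega

/-! ### Part B. Per facet: contact sides of the fan triangles = contact sides of the polygon -/

/-- **Per facet, the fan triangles have as many contact sides as the facet polygon has contact
sides**: with `w = fVert X c` and `m = m_c ≥ 3`,
`Σ_{i<m−2} fanContacts X c i = #{j < m : ⟪w j, w ((j+1) % m)⟫ = 1/2}` — each polygon side lies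
in exactly one fan triangle, the diagonals `{w 0, w k}` (`2 ≤ k ≤ m−2`) in two, and diagonals are
not contacts. [cite: Hales2012, proof of Theorem 2 (triangulation of U_F)] -/
theorem sum_fanContacts_eq_card_filter (hX1 : ∀ y ∈ X, ‖y‖ = 1)
    (hp : ∀ y ∈ X, ∀ y' ∈ X, y ≠ y' → ⟪y, y'⟫ ≤ 1 / 2)
    (h0 : (0 : E3) ∈ interior (convexHull ℝ (X : Set E3))) {c : E3} (hc : c ∈ facetNormals X) :
    ∑ i ∈ range ((tightSet X c).card - 2), fanContacts X c i =
      ((range (tightSet X c).card).filter fun j =>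
        ⟪fVert X c j, fVert X c ((j + 1) % (tightSet X c).card)⟫ = 1 / 2).card := by
  set m := (tightSet X c).card with hm
  have hm3 : 3 ≤ m := three_le_card_tightSet hc
  obtain ⟨n, hn⟩ : ∃ n, m = n + 3 := ⟨m - 3, by omega⟩
  set w := fVert X c with hw
  -- diagonals are not contacts
  have hdiag : ∀ k, 2 ≤ k → k + 2 ≤ m → (if ⟪w 0, w k⟫ = 1 / 2 then 1 else 0 : ℕ) = 0 :=
    fun k hk2 hkm => by
    rw [if_neg (inner_fVert_zero_ne_half_of_diagonal hX1 hp h0 hc hk2 (hm ▸ hkm))]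
  have hfc : ∀ i, fanContacts X c i = (if ⟪w (i + 1), w (i + 2)⟫ = 1 / 2 then 1 else 0) +
      (if ⟪w 0, w (i + 2)⟫ = 1 / 2 then 1 else 0) + (if ⟪w 0, w (i + 1)⟫ = 1 / 2 then 1 else 0) :=
    fun i => rfl
  -- left-hand side
  rw [hn, show n + 3 - 2 = n + 1 by omega]
  rw [Finset.sum_congr rfl fun i _ => hfc i, sum_add_distrib, sum_add_distrib]
  have hB : ∑ i ∈ range (n + 1), (if ⟪w 0, w (i + 1)⟫ = 1 / 2 then 1 else 0 : ℕ) =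
      (if ⟪w 0, w 1⟫ = 1 / 2 then 1 else 0 : ℕ) := by
    rw [sum_range_succ']
    rw [Finset.sum_eq_zero fun i hi => ?_]
    · simp
    · exact hdiag (i + 1 + 1) (by omega) (by have := mem_range.1 hi; omega)
  have hC : ∑ i ∈ range (n + 1), (if ⟪w 0, w (i + 2)⟫ = 1 / 2 then 1 else 0 : ℕ) =
      (if ⟪w 0, w (n + 2)⟫ = 1 / 2 then 1 else 0 : ℕ) := by
    rw [sum_range_succ]
    rw [Finset.sum_eq_zero fun i hi => ?_]
    · simp
    · exact hdiag (i + 2) (by omega) (by have := mem_range.1 hi; omega)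
  rw [hB, hC]
  -- right-hand side
  have hR : ((range (n + 3)).filter fun j => ⟪w j, w ((j + 1) % (n + 3))⟫ = 1 / 2).card =
      (∑ i ∈ range (n + 1), (if ⟪w (i + 1), w (i + 2)⟫ = 1 / 2 then 1 else 0 : ℕ)) +
        (if ⟪w 0, w 1⟫ = 1 / 2 then 1 else 0 : ℕ) +
        (if ⟪w 0, w (n + 2)⟫ = 1 / 2 then 1 else 0 : ℕ) := by
    rw [card_filter, sum_range_succ, sum_range_succ']
    have hlast : (n + 2 + 1) % (n + 3) = 0 := by
      rw [show n + 2 + 1 = n + 3 by ring, Nat.mod_self]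
    have hfirst : (0 + 1) % (n + 3) = 1 := Nat.mod_eq_of_lt (by omega)
    have hmid : ∀ i ∈ range (n + 1), (i + 1 + 1) % (n + 3) = i + 2 := fun i hi =>
      Nat.mod_eq_of_lt (by have := mem_range.1 hi; omega)
    rw [hlast, hfirst, real_inner_comm (w (n + 2)) (w 0)]
    rw [Finset.sum_congr rfl fun i hi => by rw [hmid i hi]]
  rw [hR]
  ring

/-! ### Part C. All facets: contact sides of the polygons = twice the contact pairs -/

/-- **A pair of distinct points of `X` is a contact pair iff its inner product is `κ`.**
[folklore] -/
theorem pair_mem_contactPairsAt_iff {κ : ℝ} {u v : E3} (hu : u ∈ X) (hv : v ∈ X) (hne : u ≠ v) :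
    ({u, v} : Finset E3) ∈ contactPairsAt X κ ↔ ⟪u, v⟫ = κ := by
  classical
  unfold contactPairsAt
  rw [mem_filter, mem_powerset]
  constructor
  · rintro ⟨-, u', v', hne', huv', heq⟩
    have hmem : ∀ x ∈ ({u, v} : Finset E3), x ∈ ({u', v'} : Finset E3) := fun x hx => heq ▸ hx
    have hu' := hmem u (mem_insert_self _ _)
    have hv' := hmem v (mem_insert_of_mem (mem_singleton_self _))
    rw [mem_insert, mem_singleton] at hu' hv'
    rcases hu' with rfl | rfl <;> rcases hv' with rfl | rfl
    · exact absurd rfl hne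
    · exact huv'
    · rw [real_inner_comm]; exact huv'
    · exact absurd rfl hne
  · intro h
    refine ⟨?_, u, v, hne, h, rfl⟩
    intro x hx
    rw [mem_insert, mem_singleton] at hx
    rcases hx with rfl | rfl
    · exact hu
    · exact hv

/-- **The contact sides of a facet polygon, counted by index, are the contact pairs among its
hull edges.** [folklore] -/
theorem card_filter_index_eq_card_filter_edges (hX1 : ∀ y ∈ X, ‖y‖ = 1)
    (h0 : (0 : E3) ∈ interior (convexHull ℝ (X : Set E3))) {c : E3} (hc : c ∈ facetNormals X) :
    ((range (tightSet X c).card).filter fun j =>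
        ⟪fVert X c j, fVert X c ((j + 1) % (tightSet X c).card)⟫ = 1 / 2).card =
      ((edgesOfFacet X c).filter fun T => T ∈ contactPairsAt X (1 / 2)).card := by
  classical
  set hc0 := ne_zero_of_mem_facetNormals hX1 hc
  set m := (facetAngles X c hc0).card with hm
  have hmt : (tightSet X c).card = m := (card_facetAngles hX1 hc0).symm
  set g : ℕ → Finset E3 := fun j =>
    ({facetVertex X c hc0 j, facetVertex X c hc0 ((j + 1) % m)} : Finset E3) with hg
  have himg : edgesOfFacet X c = (range m).image g := edgesOfFacet_eq_image hX1 h0 hc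
  have hinj : Set.InjOn g (range m : Set ℕ) := by
    have hcard : ((range m).image g).card = (range m).card := by
      rw [← himg, card_edgesOfFacet hX1 h0 hc, hmt, card_range]
    exact Finset.card_image_iff.1 hcard
  rw [himg, Finset.filter_image, Finset.card_image_of_injOn (fun a ha b hb hab =>
    hinj (Finset.mem_coe.2 (Finset.mem_filter.1 (Finset.mem_coe.1 ha)).1)
      (Finset.mem_coe.2 (Finset.mem_filter.1 (Finset.mem_coe.1 hb)).1) hab), hmt]
  congr 1
  refine Finset.filter_congr fun j hj => ?_
  have hjm := mem_range.1 hj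
  have hj1 : (j + 1) % m < m := Nat.mod_lt _ (by omega)
  have hvj := facetVertex_mem hc0 hjm
  have hvj1 := facetVertex_mem hc0 hj1
  have hne : facetVertex X c hc0 j ≠ facetVertex X c hc0 ((j + 1) % m) := fun h => by
    have := facetVertex_injOn hc0 (mem_coe.2 (mem_range.2 hjm)) (mem_coe.2 (mem_range.2 hj1)) h
    -- `j = (j+1) % m` is impossible for `m ≥ 3`
    have hm3 : 3 ≤ m := by rw [← hmt]; exact three_le_card_tightSet hc
    rcases Nat.lt_or_ge (j + 1) m with hlt | hge
    · rw [Nat.mod_eq_of_lt hlt] at this; omega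
    · have hjm1 : j = m - 1 := by omega
      rw [hjm1, show m - 1 + 1 = m by omega, Nat.mod_self] at this; omega
  rw [fVert_eq hc0, fVert_eq hc0]
  simp only [hg]
  exact (pair_mem_contactPairsAt_iff (mem_tightSet.1 hvj).1 (mem_tightSet.1 hvj1).1 hne).symm

/-- **Summed over the facets, the contact sides of the polygons count every contact pair exactly
twice** (contact pairs are hull edges, `contactPairsAt_subset_hullEdges`, and every hull edge
lies in exactly two facets, `card_facetsOfEdge`). [folklore] -/
theorem sum_card_contact_sides_eq (hX1 : ∀ y ∈ X, ‖y‖ = 1)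
    (hp : ∀ y ∈ X, ∀ y' ∈ X, y ≠ y' → ⟪y, y'⟫ ≤ 1 / 2)
    (h0 : (0 : E3) ∈ interior (convexHull ℝ (X : Set E3))) :
    ∑ c ∈ facetNormals X, ((edgesOfFacet X c).filter fun T => T ∈ contactPairsAt X (1 / 2)).card =
      2 * (contactPairsAt X (1 / 2)).card := by
  classical
  have hsub : contactPairsAt X (1 / 2) ⊆ hullEdges X :=
    contactPairsAt_subset_hullEdges hX1 (by norm_num) hp
  calc ∑ c ∈ facetNormals X, ((edgesOfFacet X c).filter fun T => T ∈ contactPairsAt X (1 / 2)).card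
      = ∑ c ∈ facetNormals X, ∑ T ∈ (edgesOfFacet X c).filter
          (fun T => T ∈ contactPairsAt X (1 / 2)), 1 := by simp
    _ = ∑ T ∈ contactPairsAt X (1 / 2), ∑ c ∈ facetsOfEdge X T, 1 := by
        refine Finset.sum_comm' fun c T => ?_
        simp only [edgesOfFacet, facetsOfEdge, mem_filter]
        constructor
        · rintro ⟨hcF, ⟨-, hTc⟩, hTC⟩
          exact ⟨⟨hcF, hTc⟩, hTC⟩
        · rintro ⟨⟨hcF, hTc⟩, hTC⟩
          exact ⟨hcF, ⟨hsub hTC, hTc⟩, hTC⟩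
    _ = ∑ T ∈ contactPairsAt X (1 / 2), 2 := Finset.sum_congr rfl fun T hT => by
        rw [sum_const, smul_eq_mul, mul_one, card_facetsOfEdge hX1 h0 (hsub hT)]
    _ = 2 * (contactPairsAt X (1 / 2)).card := by rw [sum_const, smul_eq_mul, mul_comm]

/-! ### Part D. The number of fan triangles and the assembled identity -/

/-- **There are `20` fan triangles**: `Σ_c (m_c − 2) = 20` for twelve unit vectors with `0` in
the interior of their hull (Legendre's identity `Σ m_c = 2·12 + 2F − 4`).
[cite: Hales2012, Lemma 5 (4π − 20 sol₀: twenty triangles)] -/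
theorem card_fanTriangles (h12 : X.card = 12) (hX1 : ∀ y ∈ X, ‖y‖ = 1)
    (h0 : (0 : E3) ∈ interior (convexHull ℝ (X : Set E3))) :
    ∑ c ∈ facetNormals X, ((tightSet X c).card - 2) = 20 := by
  have h := sum_card_tightSet_eq hX1 h0
  rw [h12] at h
  have h3 : ∀ c ∈ facetNormals X, 3 ≤ (tightSet X c).card := fun c hc => three_le_card_tightSet hc
  have hcast : ((∑ c ∈ facetNormals X, ((tightSet X c).card - 2) : ℕ) : ℝ) =
      ∑ c ∈ facetNormals X, ((tightSet X c).card : ℝ) - 2 * (facetNormals X).card := by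
    push_cast
    rw [Finset.sum_congr rfl fun c hc => by rw [Nat.cast_sub (by have := h3 c hc; omega)],
      Finset.sum_sub_distrib]
    simp [Finset.sum_const, nsmul_eq_mul, mul_comm]
  have : ((∑ c ∈ facetNormals X, ((tightSet X c).card - 2) : ℕ) : ℝ) = 20 := by
    rw [hcast, h]; ring
  exact_mod_cast this

/-- **The long sides of the fan triangles, counted with multiplicity**: for twelve unit vectors
whose distinct pairs have inner product `≤ 1/2` (in particular for `V/2`, `V ∈ 𝒱`),
`Σ_c Σ_{i<m_c−2} (3 − fanContacts X c i) = 60 − 2 · #contactPairsAt X (1/2)` (as reals).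
[cite: Hales2012, proof of Theorem 3 (edge and face counts)] -/
theorem sum_sum_three_sub_fanContacts (h12 : X.card = 12) (hX1 : ∀ y ∈ X, ‖y‖ = 1)
    (hp : ∀ y ∈ X, ∀ y' ∈ X, y ≠ y' → ⟪y, y'⟫ ≤ 1 / 2) :
    ∑ c ∈ facetNormals X, ∑ i ∈ range ((tightSet X c).card - 2),
        (3 - (fanContacts X c i : ℝ)) = 60 - 2 * (contactPairsAt X (1 / 2)).card := by
  have h0 := zero_mem_interior_convexHull_of_twelve_unit h12 hX1 hp
  have hT := card_fanTriangles h12 hX1 h0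
  have hE := sum_card_contact_sides_eq hX1 hp h0
  have hsum : ∀ c ∈ facetNormals X, ∑ i ∈ range ((tightSet X c).card - 2),
      (3 - (fanContacts X c i : ℝ)) = 3 * (((tightSet X c).card - 2 : ℕ) : ℝ) -
        ((edgesOfFacet X c).filter fun T => T ∈ contactPairsAt X (1 / 2)).card := by
    intro c hc
    rw [Finset.sum_sub_distrib, sum_const, card_range, nsmul_eq_mul, mul_comm,
      ← card_filter_index_eq_card_filter_edges hX1 h0 hc,
      ← sum_fanContacts_eq_card_filter hX1 hp h0 hc]
    push_cast
    ring
  rw [Finset.sum_congr rfl hsum, Finset.sum_sub_distrib, ← Finset.mul_sum]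
  have hT' : ∑ c ∈ facetNormals X, (((tightSet X c).card - 2 : ℕ) : ℝ) = 20 := by
    exact_mod_cast hT
  have hE' : ∑ c ∈ facetNormals X,
      (((edgesOfFacet X c).filter fun T => T ∈ contactPairsAt X (1 / 2)).card : ℝ) =
      2 * (contactPairsAt X (1 / 2)).card := by exact_mod_cast hE
  rw [hT', hE']
  ring

end FanCensus

end Literature.Geometry.DiscreteGeometry

end
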